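import Summits.KontsevichZagierPeriods.KontsevichZagierPeriods.Theorems.HyperellipticRiemannRelation.Negative.SignPatterns
import Summits.KontsevichZagierPeriods.KontsevichZagierPeriods.Theorems.HyperellipticRiemannRelation.Negative.Witnesses

/-!
# `HyperellipticRiemannRelation` (stmt-KontsevichZagierPeriods-3522) — negative knowledge, part 4: distinct roots are load-bearing

Support file for the crux `UnfoldedStokes.HyperellipticRiemannRelation` (cdisprove seat, cycle 1;
work file `Cruxes/HyperellipticRiemannRelation/Disproof.lean`). Part 3 shows that the ORDER of
the roots is load-bearing (non-monotone witness). Here the natural weakening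
`StrictMono e ↦ Monotone e` (coincident roots allowed) is refuted: at the DOUBLE ROOT
configuration `e = (0,1,2,3,3)` (sextic-degenerate quintic `g(t) = t(t−1)(t−2)(t−3)²`, the
genus drops to `1`) the boxes of `r₁₄` and `r₃₄` (`x 1 ∈ (3,3)`) are empty while
`J₁ × J₂ = (0,1) × (1,2)` carries an admissible representation of POSITIVE value, so the
combination has value `W₁₂(g) ≠ 0` (`hyperellipticRiemannRelation_false_without_strictness`).
The witness on `(0,1) × (1,2)` is built as in part 2: `g > 0` on `(0,1)`, `g < 0` on `(1,2)`,
integrand `(x 1 − x 0)·√(1/(−g(x 0)g(x 1)))` semialgebraic, dominated by `2·u(x 0)u(x 1)` with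
`u = 1/√|g| ≤ (√(t−a))⁻¹ + (√(a+1−t))⁻¹` on the unit gaps. No definitions are introduced.
[Kontsevich–Zagier 2001, §1.1–1.2] [folklore]
-/

noncomputable section

open Set MeasureTheory MvPolynomial
open Literature.NumberTheory.Transcendental Literature.ModelTheory.ExponentialFields
open Summit.KontsevichZagierPeriods.HermiteRigidity.GenusTwoCycleTransferNegative
  (inv_sqrt_le_model integrableOn_model)

namespace Summit.KontsevichZagierPeriods.UnfoldedStokes.HyperellipticRiemannRelationNegative

/-! ### §1 The double-root configuration `e = (0,1,2,3,3)` -/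

/-- `(0,1,2,3,3)` is monotone. [folklore] -/
theorem monotone_e₂ : Monotone (![0, 1, 2, 3, 3] : Fin 5 → ℚ) :=
  Fin.monotone_iff_le_succ.2 (by decide)

/-- … but not strictly monotone (`e 3 = e 4`). [folklore] -/
theorem not_strictMono_e₂ : ¬ StrictMono (![0, 1, 2, 3, 3] : Fin 5 → ℚ) := fun h => by
  have := h (show (3 : Fin 5) < 4 by decide)
  simp at this

/-- The crux's product at `e = (0,1,2,3,3)` is the degenerate quintic `g`. [folklore] -/
theorem prod_e₂ (t : ℝ) :
    ∏ i : Fin 5, (t - ((![0, 1, 2, 3, 3] : Fin 5 → ℚ) i : ℝ)) = t * (t - 1) * (t - 2) * (t - 3) * (t - 3) := by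
  simp [Fin.prod_univ_five]

/-- On `(0,1)`: `t(1−t) ≤ g(t)` (cofactor `(2−t)(3−t)² ≥ 1`). [folklore] -/
theorem dquintic_ge_01 {t : ℝ} (ht : t ∈ Ioo (0:ℝ) 1) :
    (t - 0) * (0 + 1 - t) ≤ t * (t - 1) * (t - 2) * (t - 3) * (t - 3) := by
  have hg : (1:ℝ) ≤ (2 - t) * ((3 - t) * (3 - t)) :=
    one_le_mul_of_one_le_of_one_le (by linarith [ht.2])
      (one_le_mul_of_one_le_of_one_le (by linarith [ht.2]) (by linarith [ht.2]))
  have h0 : 0 ≤ t * (1 - t) := mul_nonneg ht.1.le (by linarith [ht.2])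
  have : t * (t - 1) * (t - 2) * (t - 3) * (t - 3) = t * (1 - t) * ((2 - t) * ((3 - t) * (3 - t))) := by
    ring
  rw [this]
  calc (t - 0) * (0 + 1 - t) = t * (1 - t) * 1 := by ring
    _ ≤ t * (1 - t) * ((2 - t) * ((3 - t) * (3 - t))) := mul_le_mul_of_nonneg_left hg h0

/-- `g > 0` on `(0,1)`. [folklore] -/
theorem dquintic_pos_01 {t : ℝ} (ht : t ∈ Ioo (0:ℝ) 1) : 0 < t * (t - 1) * (t - 2) * (t - 3) * (t - 3) :=
  lt_of_lt_of_le (by nlinarith [ht.1, ht.2]) (dquintic_ge_01 ht)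

/-- On `(1,2)`: `(t−1)(2−t) ≤ −g(t)` (cofactor `t(3−t)² ≥ 1`). [folklore] -/
theorem neg_dquintic_ge_12 {t : ℝ} (ht : t ∈ Ioo (1:ℝ) 2) :
    (t - 1) * (1 + 1 - t) ≤ -(t * (t - 1) * (t - 2) * (t - 3) * (t - 3)) := by
  have hg : (1:ℝ) ≤ t * ((3 - t) * (3 - t)) :=
    one_le_mul_of_one_le_of_one_le (by linarith [ht.1])
      (one_le_mul_of_one_le_of_one_le (by linarith [ht.2]) (by linarith [ht.2]))
  have h0 : 0 ≤ (t - 1) * (2 - t) := mul_nonneg (by linarith [ht.1]) (by linarith [ht.2])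
  have : -(t * (t - 1) * (t - 2) * (t - 3) * (t - 3)) = (t - 1) * (2 - t) * (t * ((3 - t) * (3 - t))) := by
    ring
  rw [this]
  calc (t - 1) * (1 + 1 - t) = (t - 1) * (2 - t) * 1 := by ring
    _ ≤ (t - 1) * (2 - t) * (t * ((3 - t) * (3 - t))) := mul_le_mul_of_nonneg_left hg h0

/-- `g < 0` on `(1,2)`. [folklore] -/
theorem dquintic_neg_12 {t : ℝ} (ht : t ∈ Ioo (1:ℝ) 2) : t * (t - 1) * (t - 2) * (t - 3) * (t - 3) < 0 := by
  have h : 0 < (t - 1) * (1 + 1 - t) := mul_pos (by linarith [ht.1]) (by linarith [ht.2])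
  linarith [neg_dquintic_ge_12 ht]

/-! ### §2 Integrability -/

/-- `u = 1/√|g|` is Borel measurable. [folklore] -/
theorem measurable_du : Measurable (fun t : ℝ => 1 / Real.sqrt |t * (t - 1) * (t - 2) * (t - 3) * (t - 3)|) := by
  fun_prop

/-- `u = 1/√|g|` is integrable on `(0,1)`. [folklore] -/
theorem integrableOn_du_01 :
    IntegrableOn (fun t : ℝ => 1 / Real.sqrt |t * (t - 1) * (t - 2) * (t - 3) * (t - 3)|) (Ioo 0 1) := by
  refine Integrable.mono' (integrableOn_model 0 (0 + 1) |>.mono_set (by norm_num))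
    measurable_du.aestronglyMeasurable ?_
  filter_upwards [ae_restrict_mem measurableSet_Ioo] with t ht
  rw [Real.norm_of_nonneg (by positivity), abs_of_pos (dquintic_pos_01 ht)]
  exact inv_sqrt_le_model (a := 0) (by simpa using ht) (dquintic_ge_01 ht)

/-- `u = 1/√|g|` is integrable on `(1,2)`. [folklore] -/
theorem integrableOn_du_12 :
    IntegrableOn (fun t : ℝ => 1 / Real.sqrt |t * (t - 1) * (t - 2) * (t - 3) * (t - 3)|) (Ioo 1 2) := by
  refine Integrable.mono' (integrableOn_model 1 (1 + 1) |>.mono_set (by norm_num))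
    measurable_du.aestronglyMeasurable ?_
  filter_upwards [ae_restrict_mem measurableSet_Ioo] with t ht
  rw [Real.norm_of_nonneg (by positivity), abs_of_neg (dquintic_neg_12 ht)]
  exact inv_sqrt_le_model (a := 1) (by norm_num at ht ⊢; exact ht) (neg_dquintic_ge_12 ht)

/-- The crux integrand at `e = (0,1,2,3,3)`, written with `g`. [folklore] -/
theorem integrand_e₂ (x : Fin 2 → ℝ) :
    (x 1 - x 0) / Real.sqrt (|∏ i : Fin 5, (x 0 - ((![0, 1, 2, 3, 3] : Fin 5 → ℚ) i : ℝ))| *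
      |∏ i : Fin 5, (x 1 - ((![0, 1, 2, 3, 3] : Fin 5 → ℚ) i : ℝ))|) =
    (x 1 - x 0) / Real.sqrt (|x 0 * (x 0 - 1) * (x 0 - 2) * (x 0 - 3) * (x 0 - 3)| *
      |x 1 * (x 1 - 1) * (x 1 - 2) * (x 1 - 3) * (x 1 - 3)|) := by
  rw [prod_e₂, prod_e₂]

/-- The crux integrand at `e = (0,1,2,3,3)` is Borel measurable. [folklore] -/
theorem measurable_integrand_e₂ : Measurable (fun x : Fin 2 → ℝ => (x 1 - x 0) /
    Real.sqrt (|∏ i : Fin 5, (x 0 - ((![0, 1, 2, 3, 3] : Fin 5 → ℚ) i : ℝ))| *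
      |∏ i : Fin 5, (x 1 - ((![0, 1, 2, 3, 3] : Fin 5 → ℚ) i : ℝ))|)) := by
  fun_prop

/-- The crux integrand at `e = (0,1,2,3,3)` is integrable on `(0,1) × (1,2)`
(`0 ≤ G ≤ 2·u(x 0)u(x 1)` there). [folklore] -/
theorem integrableOn_integrand_e₂ :
    IntegrableOn (fun x : Fin 2 → ℝ => (x 1 - x 0) /
      Real.sqrt (|∏ i : Fin 5, (x 0 - ((![0, 1, 2, 3, 3] : Fin 5 → ℚ) i : ℝ))| *
        |∏ i : Fin 5, (x 1 - ((![0, 1, 2, 3, 3] : Fin 5 → ℚ) i : ℝ))|))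
      {x | (0:ℝ) < x 0 ∧ x 0 < 1 ∧ (1:ℝ) < x 1 ∧ x 1 < 2} := by
  have hmeas : MeasurableSet {x : Fin 2 → ℝ | (0:ℝ) < x 0 ∧ x 0 < 1 ∧ (1:ℝ) < x 1 ∧ x 1 < 2} :=
    (measurableSet_lt measurable_const (measurable_pi_apply 0)).inter
      ((measurableSet_lt (measurable_pi_apply 0) measurable_const).inter
      ((measurableSet_lt measurable_const (measurable_pi_apply 1)).inter
      (measurableSet_lt (measurable_pi_apply 1) measurable_const)))
  refine Integrable.mono' ((integrableOn_box_mul integrableOn_du_01 integrableOn_du_12).const_mul 2)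
    measurable_integrand_e₂.aestronglyMeasurable ?_
  filter_upwards [ae_restrict_mem hmeas] with x hx
  obtain ⟨h0a, h0b, h1c, h1d⟩ := hx
  rw [integrand_e₂]
  have hnum : 0 ≤ x 1 - x 0 := by linarith
  have hnum2 : x 1 - x 0 ≤ 2 := by linarith
  set A := |x 0 * (x 0 - 1) * (x 0 - 2) * (x 0 - 3) * (x 0 - 3)| with hA
  set B := |x 1 * (x 1 - 1) * (x 1 - 2) * (x 1 - 3) * (x 1 - 3)| with hB
  have hA0 : 0 ≤ A := abs_nonneg _
  have hsq : Real.sqrt (A * B) = Real.sqrt A * Real.sqrt B := Real.sqrt_mul hA0 B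
  rw [Real.norm_of_nonneg (div_nonneg hnum (Real.sqrt_nonneg _)), hsq]
  have hprod : 0 ≤ 1 / Real.sqrt A * (1 / Real.sqrt B) := by positivity
  calc (x 1 - x 0) / (Real.sqrt A * Real.sqrt B)
      = (x 1 - x 0) * (1 / Real.sqrt A * (1 / Real.sqrt B)) := by ring
    _ ≤ 2 * (1 / Real.sqrt A * (1 / Real.sqrt B)) := mul_le_mul_of_nonneg_right hnum2 hprod

/-- The crux integrand at `e = (0,1,2,3,3)` is `ℚ`-semialgebraic on `(0,1) × (1,2)`
(`|g(x 0)|·|g(x 1)| = −g(x 0)g(x 1) > 0` there). [cite: BochnakCosteRoy1998, Prop. 2.2.6] -/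
theorem isSemialgebraicFunOn_integrand_e₂ :
    IsSemialgebraicFunOn ℚ {x : Fin 2 → ℝ | (0:ℝ) < x 0 ∧ x 0 < 1 ∧ (1:ℝ) < x 1 ∧ x 1 < 2}
      (fun x : Fin 2 → ℝ => (x 1 - x 0) /
        Real.sqrt (|∏ i : Fin 5, (x 0 - ((![0, 1, 2, 3, 3] : Fin 5 → ℚ) i : ℝ))| *
          |∏ i : Fin 5, (x 1 - ((![0, 1, 2, 3, 3] : Fin 5 → ℚ) i : ℝ))|)) := by
  have hσ : IsSemialgebraic ℚ {x : Fin 2 → ℝ | (0:ℝ) < x 0 ∧ x 0 < 1 ∧ (1:ℝ) < x 1 ∧ x 1 < 2} := by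
    simpa using isSemialgebraic_box 0 1 1 2
  have hneg : ∀ x ∈ {x : Fin 2 → ℝ | (0:ℝ) < x 0 ∧ x 0 < 1 ∧ (1:ℝ) < x 1 ∧ x 1 < 2},
      x 0 * (x 0 - 1) * (x 0 - 2) * (x 0 - 3) * (x 0 - 3) *
        (x 1 * (x 1 - 1) * (x 1 - 2) * (x 1 - 3) * (x 1 - 3)) < 0 := fun x hx =>
    mul_neg_of_pos_of_neg (dquintic_pos_01 ⟨hx.1, hx.2.1⟩) (dquintic_neg_12 ⟨hx.2.2.1, hx.2.2.2⟩)
  have hq : ∀ x ∈ {x : Fin 2 → ℝ | (0:ℝ) < x 0 ∧ x 0 < 1 ∧ (1:ℝ) < x 1 ∧ x 1 < 2},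
      aeval x (-((X 0 * (X 0 - 1) * (X 0 - 2) * (X 0 - 3) * (X 0 - 3)) *
        (X 1 * (X 1 - 1) * (X 1 - 2) * (X 1 - 3) * (X 1 - 3))) : MvPolynomial (Fin 2) ℚ) ≠ 0 := by
    intro x hx
    have := hneg x hx
    simp only [map_neg, map_mul, map_sub, aeval_X, map_one, map_ofNat]
    linarith
  have hrat := isSemialgebraicFunOn_aeval_div_aeval hσ (1 : MvPolynomial (Fin 2) ℚ) _ hq
  have hsqrt := IsSemialgebraicFunOn.sqrt_holds hrat
  have hlin := isSemialgebraicFunOn_aeval hσ (X 1 - X 0 : MvPolynomial (Fin 2) ℚ)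
  have hmul := IsSemialgebraicFunOn.mul_holds hlin hsqrt
  refine hmul.congr fun x hx => ?_
  simp only [Pi.mul_apply, map_sub, aeval_X, map_one, map_neg, map_mul, map_ofNat]
  rw [integrand_e₂, ← abs_mul, abs_of_neg (hneg x hx), Real.sqrt_div' _ (by linarith [hneg x hx]),
    Real.sqrt_one]
  ring

/-- **Witness at the double root**: an admissible `r₁₂` on `(0,1) × (1,2)` for `e = (0,1,2,3,3)`
exists and has POSITIVE value. [cite: KontsevichZagier2001, §1.1] -/
theorem exists_rep₁₂_e₂ : ∃ r : KZ.IntegralRep 2,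
    r.domain = {x | (0:ℝ) < x 0 ∧ x 0 < 1 ∧ (1:ℝ) < x 1 ∧ x 1 < 2} ∧
    r.integrand = (fun x : Fin 2 → ℝ => (x 1 - x 0) /
      Real.sqrt (|∏ i : Fin 5, (x 0 - ((![0, 1, 2, 3, 3] : Fin 5 → ℚ) i : ℝ))| *
        |∏ i : Fin 5, (x 1 - ((![0, 1, 2, 3, 3] : Fin 5 → ℚ) i : ℝ))|)) ∧ 0 < r.value := by
  have hσ : IsSemialgebraic ℚ {x : Fin 2 → ℝ | (0:ℝ) < x 0 ∧ x 0 < 1 ∧ (1:ℝ) < x 1 ∧ x 1 < 2} := by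
    simpa using isSemialgebraic_box 0 1 1 2
  refine ⟨⟨_, _, hσ, isSemialgebraicFunOn_integrand_e₂, integrableOn_integrand_e₂⟩, rfl, rfl, ?_⟩
  have hm : MeasurableSet {x : Fin 2 → ℝ | (0:ℝ) < x 0 ∧ x 0 < 1 ∧ (1:ℝ) < x 1 ∧ x 1 < 2} :=
    IsSemialgebraic.measurableSet_holds hσ
  have hpos : ∀ x ∈ {x : Fin 2 → ℝ | (0:ℝ) < x 0 ∧ x 0 < 1 ∧ (1:ℝ) < x 1 ∧ x 1 < 2},
      0 < (x 1 - x 0) / Real.sqrt (|∏ i : Fin 5, (x 0 - ((![0, 1, 2, 3, 3] : Fin 5 → ℚ) i : ℝ))| *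
        |∏ i : Fin 5, (x 1 - ((![0, 1, 2, 3, 3] : Fin 5 → ℚ) i : ℝ))|) := by
    intro x hx
    rw [integrand_e₂]
    exact div_pos (by linarith [hx.2.1, hx.2.2.1]) (Real.sqrt_pos.2 (mul_pos
      (abs_pos.2 (dquintic_pos_01 ⟨hx.1, hx.2.1⟩).ne') (abs_pos.2 (dquintic_neg_12 ⟨hx.2.2.1, hx.2.2.2⟩).ne)))
  show 0 < ∫ x in {x : Fin 2 → ℝ | (0:ℝ) < x 0 ∧ x 0 < 1 ∧ (1:ℝ) < x 1 ∧ x 1 < 2}, _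
  rw [setIntegral_pos_iff_support_of_nonneg_ae ((ae_restrict_mem hm).mono fun x hx => (hpos x hx).le)
    integrableOn_integrand_e₂]
  have hsupp : Function.support (fun x : Fin 2 → ℝ => (x 1 - x 0) /
      Real.sqrt (|∏ i : Fin 5, (x 0 - ((![0, 1, 2, 3, 3] : Fin 5 → ℚ) i : ℝ))| *
        |∏ i : Fin 5, (x 1 - ((![0, 1, 2, 3, 3] : Fin 5 → ℚ) i : ℝ))|)) ∩
      {x : Fin 2 → ℝ | (0:ℝ) < x 0 ∧ x 0 < 1 ∧ (1:ℝ) < x 1 ∧ x 1 < 2} =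
      {x : Fin 2 → ℝ | (0:ℝ) < x 0 ∧ x 0 < 1 ∧ (1:ℝ) < x 1 ∧ x 1 < 2} :=
    inter_eq_right.2 fun x hx => Function.mem_support.2 (hpos x hx).ne'
  rw [hsupp]
  exact volume_box_pos zero_lt_one one_lt_two

/-! ### §3 Distinctness of the roots is load-bearing -/

/-- The box of `r₁₂` at `e = (0,1,2,3,3)`. [folklore] -/
theorem box₁₂_e₂ : {x : Fin 2 → ℝ | ((![0, 1, 2, 3, 3] : Fin 5 → ℚ) 0 : ℝ) < x 0 ∧
    x 0 < ((![0, 1, 2, 3, 3] : Fin 5 → ℚ) 1 : ℝ) ∧ ((![0, 1, 2, 3, 3] : Fin 5 → ℚ) 1 : ℝ) < x 1 ∧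
    x 1 < ((![0, 1, 2, 3, 3] : Fin 5 → ℚ) 2 : ℝ)} = {x | (0:ℝ) < x 0 ∧ x 0 < 1 ∧ (1:ℝ) < x 1 ∧ x 1 < 2} := by
  ext x; simp

/-- The box of `r₁₄` at `e = (0,1,2,3,3)` (EMPTY: `x 1 ∈ (3,3)`). [folklore] -/
theorem box₁₄_e₂ : {x : Fin 2 → ℝ | ((![0, 1, 2, 3, 3] : Fin 5 → ℚ) 0 : ℝ) < x 0 ∧
    x 0 < ((![0, 1, 2, 3, 3] : Fin 5 → ℚ) 1 : ℝ) ∧ ((![0, 1, 2, 3, 3] : Fin 5 → ℚ) 3 : ℝ) < x 1 ∧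
    x 1 < ((![0, 1, 2, 3, 3] : Fin 5 → ℚ) 4 : ℝ)} = {x | (0:ℝ) < x 0 ∧ x 0 < 1 ∧ (3:ℝ) < x 1 ∧ x 1 < 3} := by
  ext x; simp

/-- The box of `r₃₄` at `e = (0,1,2,3,3)` (EMPTY: `x 1 ∈ (3,3)`). [folklore] -/
theorem box₃₄_e₂ : {x : Fin 2 → ℝ | ((![0, 1, 2, 3, 3] : Fin 5 → ℚ) 2 : ℝ) < x 0 ∧
    x 0 < ((![0, 1, 2, 3, 3] : Fin 5 → ℚ) 3 : ℝ) ∧ ((![0, 1, 2, 3, 3] : Fin 5 → ℚ) 3 : ℝ) < x 1 ∧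
    x 1 < ((![0, 1, 2, 3, 3] : Fin 5 → ℚ) 4 : ℝ)} = {x | (2:ℝ) < x 0 ∧ x 0 < 3 ∧ (3:ℝ) < x 1 ∧ x 1 < 3} := by
  ext x; simp

/-- **Any proof must use that the roots are DISTINCT** (not merely ordered): the crux with
`StrictMono e` weakened to `Monotone e` is false. Witness: the double root `e = (0,1,2,3,3)`
(curve `y² = t(t−1)(t−2)(t−3)²`, genus `1`): the boxes of `r₁₄`, `r₃₄` are empty (zero
representations, value `0`), `r₁₂` is the admissible representation on `(0,1) × (1,2)` of
positive value, and the combination has non-zero value. (In the limit `e 4 → e 3` the genus-2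
relation degenerates into a genus-1 statement with logarithmic terms; the interval identity does
not survive.) [folklore] -/
theorem hyperellipticRiemannRelation_false_without_strictness :
    ¬ (∀ (e : Fin 5 → ℚ), Monotone e → ∀ (r₁₂ r₁₄ r₃₄ :
      Literature.NumberTheory.Transcendental.KZ.IntegralRep 2), r₁₂.domain = {x | (e 0 : ℝ) < x 0 ∧
      x 0 < (e 1 : ℝ) ∧ (e 1 : ℝ) < x 1 ∧ x 1 < (e 2 : ℝ)} → r₁₄.domain = {x | (e 0 : ℝ) < x 0 ∧ x
      0 < (e 1 : ℝ) ∧ (e 3 : ℝ) < x 1 ∧ x 1 < (e 4 : ℝ)} → r₃₄.domain = {x | (e 2 : ℝ) < x 0 ∧ x 0 <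
      (e 3 : ℝ) ∧ (e 3 : ℝ) < x 1 ∧ x 1 < (e 4 : ℝ)} → Set.EqOn r₁₂.integrand (fun x => (x 1 - x 0) /
      Real.sqrt (|∏ i : Fin 5, (x 0 - (e i : ℝ))| * |∏ i : Fin 5, (x 1 - (e i : ℝ))|)) r₁₂.domain →
      Set.EqOn r₁₄.integrand (fun x => (x 1 - x 0) / Real.sqrt (|∏ i : Fin 5, (x 0 - (e i : ℝ))| * |∏
      i : Fin 5, (x 1 - (e i : ℝ))|)) r₁₄.domain → Set.EqOn r₃₄.integrand (fun x => (x 1 - x 0) /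
      Real.sqrt (|∏ i : Fin 5, (x 0 - (e i : ℝ))| * |∏ i : Fin 5, (x 1 - (e i : ℝ))|)) r₃₄.domain →
      Literature.NumberTheory.Transcendental.KZ.of r₁₂ - Literature.NumberTheory.Transcendental.KZ.of
      r₁₄ + Literature.NumberTheory.Transcendental.KZ.of r₃₄ ∈
      Literature.NumberTheory.Transcendental.KZ.relations) := by
  intro H
  obtain ⟨r₁₂, hd₁₂, hi₁₂, hv₁₂⟩ := exists_rep₁₂_e₂
  have hσ₁₄ : IsSemialgebraic ℚ {x : Fin 2 → ℝ | (0:ℝ) < x 0 ∧ x 0 < 1 ∧ (3:ℝ) < x 1 ∧ x 1 < 3} := by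
    simpa using isSemialgebraic_box 0 1 3 3
  have hσ₃₄ : IsSemialgebraic ℚ {x : Fin 2 → ℝ | (2:ℝ) < x 0 ∧ x 0 < 3 ∧ (3:ℝ) < x 1 ∧ x 1 < 3} := by
    simpa using isSemialgebraic_box 2 3 3 3
  obtain ⟨z₁₄, hz₁₄, hzi₁₄, hzv₁₄⟩ := exists_zeroRep₂ hσ₁₄
  obtain ⟨z₃₄, hz₃₄, hzi₃₄, hzv₃₄⟩ := exists_zeroRep₂ hσ₃₄
  have h := H (![0, 1, 2, 3, 3]) monotone_e₂ r₁₂ z₁₄ z₃₄ (hd₁₂.trans box₁₂_e₂.symm)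
    (hz₁₄.trans box₁₄_e₂.symm) (hz₃₄.trans box₃₄_e₂.symm) (fun x _ => congrFun hi₁₂ x)
    (fun x hx => by exfalso; rw [hz₁₄] at hx; linarith [hx.2.2.1, hx.2.2.2])
    (fun x hx => by exfalso; rw [hz₃₄] at hx; linarith [hx.2.2.1, hx.2.2.2])
  have hv := (AddMonoidHom.mem_ker).1 (KZ.relations_le_ker_eval_holds h)
  rw [eval_combination, hzv₁₄, hzv₃₄] at hv
  linarith

end Summit.KontsevichZagierPeriods.UnfoldedStokes.HyperellipticRiemannRelationNegative

end
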